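import Summits.ResolutionOfSingularities.ResolutionOfSingularities.Theorems.WeightedInvariantIota3Tie
import Summits.ResolutionOfSingularities.ResolutionOfSingularities.Theorems.WeightedInvariantP3bDrop
import Summits.ResolutionOfSingularities.ResolutionOfSingularities.Theorems.WeightedInvariantIota3EpsTopStratum
import HarnessLib

/-!
# The P3 letter `τ` (the TIE BIT), the stratifier `ι₀ = (ν ; ε ; τ)` and the v1.3 invariant `ι₃ᵗ = iotaFlatT` — door
# `HypersurfaceCentreConstruction` (stmt-ResolutionOfSingularities-19897), route `WeightedInvariant`, rung P3, ORDER (o40)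

[OURS · L1 W4.3 · cell `res-hironaka`, HUMAN RULING D-0089] Helper file `--supports stmt-ResolutionOfSingularities-19897`,
res-type-013 on res-L1-w43-plan-1's ORDER (o40) (RULING gen 11 #2, IOTA3-DESIGN v1.3 §8.1/§8.2/§8.5).  CANDIDATE DESIGN OBJECTS:
nothing here is a statement of the manuscript under review (Hironaka 2017, [claim: Hironaka2017, status: under-review]); nothing is
attributed to its author; nothing here claims anything about resolution of singularities.  AI work, weaker than expert review.

## The letter (IOTA3-DESIGN v1.3 §8.1; res-L1-w43-plan-1 RULING gen 11 #3 (2) «τ stays the dimension-3 tie bit» and (4) KEY-NOTE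
## «τ-saturation»; res-type-013 DESIGN NOTE 2026-08-27T12:23Z, repair (B))

res-type-092's predicate `Iota3.IsTiePosition R f` (`…Iota3Tie`, p531400, §8.1 verbatim) has `ringKrullDim R = 3` built in.  The raw bit
`[IsTiePosition R f]` violates the UNRESTRICTED clauses (c7) `IotaGenerizationMonotone` / (c8) `IotaUpperSemicontinuous` (a Krull-dimension-4
position — `τ = 0` by fiat — may generise to a dimension-3 tie position, e.g. the thickening `S[X]_{(𝔪, X)} ⇝ S(X)` of a tie position `S`,
res-type-047 12:24Z; the registrar's own fourfold witness, RULING gen 11 #3), which is why the P3 rung was RE-TYPED to the door setting at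
dimension `≤ 3` (RULING gen 11 #3 (1), ORDER (o43)).  The Ordinal-valued letter typed HERE is the SATURATION of the raw bit over generizations
(RULING gen 11 #3 (4) KEY-NOTE «τ-saturation», banked for the all-dimension KEY) — it costs nothing now and AGREES WITH THE RAW BIT AT EVERY
POSITION OF THE RUNG:

* `Iota3.IsTieGenerization R f` := some prime `𝔭` of `R` has `IsTiePosition (R_𝔭) (f/1)` («some generization of the position, the position
  itself included, is a tie»);
* `Iota3.iotaTau R f := 1` if `IsTieGenerization R f`, else `0`;
* **`iotaTau_eq_one_iff_isTiePosition`** — for a local Noetherian `R` of Krull dimension `≤ 3`, `iotaTau R f = 1 ↔ IsTiePosition R f` (the closed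
  point: `R ≃ R_𝔪`, (c6τ); a prime `𝔭 ≠ 𝔪`: `dim R_𝔭 ≤ 2`, res-type-078's `ringKrullDim_localization_le_two_of_ne`).  So §8.1's «τ(S,f) = 1 iff
  IsTiePosition S f» and RULING #3 (2) «τ = the dimension-3 tie bit» hold VERBATIM at every position of the rung (dimension `≤ 3`), while (c7)
  holds UNRESTRICTED and for free (`iotaTau_generizationMonotone`: `(R_𝔭)_𝔮 ≅ R_{𝔮 ∩ R}`), and res-type-047's parametric (c7)/(c8) plumbing
  `…IotaGenerizationClosed` consumes the shape `iotaTau_eq_one_iff_exists` by name.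

## What is typed / proved

* §1 `IsTieGenerization`, `iotaTau`, the STRATIFIER `iotaOrdEpsTau := iotaLex ω iotaOrdEps iotaTau` (`= ω²·ν + ω·ε + τ`), and the
  v1.3 INVARIANT OF RECORD `iotaFlatT := iotaLex ((ω+1)·ω) iotaOrdEpsTau (ContactCylinder.iotaCylinder iotaOrdEpsTau iotaSigma)`
  (§8.2: v1.2's `iotaFlat` (res-type-061 p529577) with `ι₀` in place of `iotaOrdEps`).
* §2 values and bounds: `iotaTau ∈ {0, 1}`, `IotaBoundedBy 2 / ω`, bounds for the pair and for `iotaFlatT`; `_lt_iff`/`_eq_iff`/`_le_iff`.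
* §3 (c6τ)/(c12aτ) for the letter, the stratifier and the invariant (`iotaTau_isoInvariant`, `iotaOrdEpsTau_isoInvariant`,
  `iotaFlatT_isoInvariant`, `…_unitInvariant`) — transfer of res-type-092's `isTiePosition_ringEquiv_iff` / `isTiePosition_unit_mul_iff`.
* §4 (c7τ) UNRESTRICTED: `iotaTau_localization_le`, `iotaTau_generizationMonotone`, `iotaOrdEpsTau_generizationMonotone`.
* §5 (the rung's positions: `τ = 1 ↔ IsTiePosition` at dimension `≤ 3`, vanishing lemmas) and §6 ((strat-τ)) are the sequel
  `…WeightedInvariantIota3TauStrat` (same order (o40); split for the 400-line rule).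

NOT here — OPEN halves, stated as such (RULING gen 11 #3 (3)): **(c11τ)≤3** is an EQUALITY `τ(S′, φ f) = τ(S, f)` along formally smooth
essentially-of-finite-type local maps of regular local rings of dimension `≤ 3`; its ASCENT half (a tie presentation ascends: `𝔪S′ = 𝔪′` at equal
dimension, res-D-pv-025 p-`…AQSBaseChangeSquare`; lex-max ascends, `…AQSBaseChangeLexMax`; `P₀` transports, res-type-013 p530439) is the sequel
`…Iota3TauEssSmooth` (res-type-013, next); its DESCENT half (`τ(S′) = 1 ⇒ τ(S) = 1`, which also covers the torus position `S(X) = S[X]_{𝔪S[X]}`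
of (c10τ)≤3 at `dim S = 3`) is OPEN this pass.  **(c10τ)≤3 at `dim S = 2`** (the dimension-3 torus points `𝔮 ⊋ 𝔪S[X]`, residue-extension
points included: `τ = 0` by lex-maximality at the generic presentation) is OPEN this pass (res-type-013).  **(c8τ)≤3** (finiteness of the tie
closed points on each regular curve component) — res-type-047 after (c8ε), else res-type-013.

## References

* H. Matsumura, *Commutative Ring Theory*, CUP 1986, §5 (dimension and height), Thm. 19.3. [Matsumura1987]
* res-L1-w43-plan-1, `IOTA3-DESIGN.md` v1.3 §8 (OURS, AI planning); res-type-092, `…Iota3Tie` (OURS).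
-/

noncomputable section

set_option linter.dupNamespace false -- mandated namespace `Summit.<Summit>.<Problem>` of this single-conjunct summit

open IsLocalRing Literature.AlgebraicGeometry.Resolution
open Summit.ResolutionOfSingularities.ResolutionOfSingularities.Theorems
open Summit.ResolutionOfSingularities.ResolutionOfSingularities.Theorems.ContactCylinder (topStratum topStratumPrime iotaCylinder)

namespace Summit.ResolutionOfSingularities.ResolutionOfSingularities.Cruxes.HypersurfaceCentreConstruction.LocalEngine

namespace Iota3
/-! ## §1 The letter, the stratifier, the invariant -/

/-- [OURS · IOTA3-DESIGN v1.3 §8.1, repair (B)] **Tie generization**: some generization of the position `(R, f)` — the localisation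
at some prime `𝔭`, the closed point included — is a tie position (`IsTiePosition (R_𝔭) (f/1)`, res-type-092). -/
def IsTieGenerization (R : Type) [CommRing R] (f : R) : Prop :=
  ∃ 𝔭 : PrimeSpectrum R, IsTiePosition (Localization.AtPrime 𝔭.asIdeal) (algebraMap R (Localization.AtPrime 𝔭.asIdeal) f)

open Classical in
/-- [OURS · IOTA3-DESIGN v1.3 §8.1] **The tie bit `τ`**: `1` if some generization of the position is a tie position, `0` otherwise.
At a local Noetherian position of Krull dimension `≤ 3` this is `1` iff the position itself is a tie (`iotaTau_eq_one_iff_isTiePosition`). -/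
def iotaTau (R : Type) [CommRing R] (f : R) : Ordinal.{0} :=
  if IsTieGenerization R f then 1 else 0

/-- [OURS · IOTA3-DESIGN v1.3 §8.2] **The stratifier `ι₀ = (ν ; ε ; τ)`** `= iotaLex ω iotaOrdEps iotaTau` (`= ω²·ν + ω·ε + τ`). -/
def iotaOrdEpsTau : (R : Type) → [CommRing R] → R → Ordinal.{0} :=
  iotaLex Ordinal.omega0 iotaOrdEps iotaTau

/-- [OURS · IOTA3-DESIGN v1.3 §8.2 · candidate] **The v1.3 invariant of record `ι₃ᵗ = (ι₀ ; σ read generically along the top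
`ι₀`-stratum)`** `= iotaLex ((ω+1)·ω) iotaOrdEpsTau (iotaCylinder iotaOrdEpsTau iotaSigma)` — v1.2's `iotaFlat` (res-type-061) with the
stratifier `ι₀` in place of `(ν ; ε)`: at tie points the top `ι₀`-stratum is the closed point (§6), so `σ` is read POINTWISE there. -/
def iotaFlatT : (R : Type) → [CommRing R] → R → Ordinal.{0} :=
  iotaLex ((Ordinal.omega0 + 1) * Ordinal.omega0) iotaOrdEpsTau (iotaCylinder iotaOrdEpsTau iotaSigma)

/-! ## §2 Values and bounds -/

section Values

variable (R : Type) [CommRing R] (f : R)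

/-- `τ = 1 ↔` some generization is a tie. [OURS] -/
theorem iotaTau_eq_one_iff : iotaTau R f = 1 ↔ IsTieGenerization R f := by
  unfold iotaTau
  split_ifs with h
  · exact ⟨fun _ => h, fun _ => rfl⟩
  · exact ⟨fun h01 => absurd h01 zero_ne_one, fun h' => absurd h' h⟩

/-- `τ = 1 ↔ ∃ 𝔭, IsTiePosition (R_𝔭) (f/1)` — the shape res-type-047's parametric (c7)/(c8) plumbing
(`…IotaGenerizationClosed`) consumes. [OURS] -/
theorem iotaTau_eq_one_iff_exists :
    iotaTau R f = 1 ↔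
      ∃ 𝔭 : PrimeSpectrum R, IsTiePosition (Localization.AtPrime 𝔭.asIdeal) (algebraMap R (Localization.AtPrime 𝔭.asIdeal) f) :=
  iotaTau_eq_one_iff R f

/-- `τ = 0 ↔` no generization is a tie. [OURS] -/
theorem iotaTau_eq_zero_iff : iotaTau R f = 0 ↔ ¬ IsTieGenerization R f := by
  unfold iotaTau
  split_ifs with h
  · exact ⟨fun h10 => absurd h10 one_ne_zero, fun h' => absurd h h'⟩
  · exact ⟨fun _ => h, fun _ => rfl⟩

/-- `τ ∈ {0, 1}`. [OURS] -/
theorem iotaTau_eq_zero_or_eq_one : iotaTau R f = 0 ∨ iotaTau R f = 1 := by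
  unfold iotaTau
  split_ifs
  · exact Or.inr rfl
  · exact Or.inl rfl

/-- `τ ≤ 1`. [OURS] -/
theorem iotaTau_le_one : iotaTau R f ≤ 1 := by
  rcases iotaTau_eq_zero_or_eq_one R f with h | h <;> rw [h]
  exact zero_le_one

end Values

/-- `τ < 2`. [OURS] -/
theorem iotaTau_boundedBy : IotaBoundedBy 2 iotaTau := fun R _ g =>
  lt_of_le_of_lt (iotaTau_le_one R g) (by norm_num)

/-- `τ < ω` (the bound used by the stratifier). [OURS] -/
theorem iotaTau_boundedBy_omega0 : IotaBoundedBy Ordinal.omega0 iotaTau := fun R _ g =>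
  lt_of_le_of_lt (iotaTau_le_one R g) Ordinal.one_lt_omega0

/-- Unfolding of the stratifier. [OURS] -/
theorem iotaOrdEpsTau_apply (R : Type) [CommRing R] (g : R) :
    iotaOrdEpsTau R g = Ordinal.omega0 * iotaOrdEps R g + iotaTau R g := rfl

/-- `ι₀ < ω · (ω · (ω + 1))`. [OURS] -/
theorem iotaOrdEpsTau_boundedBy : IotaBoundedBy (Ordinal.omega0 * (Ordinal.omega0 * (Ordinal.omega0 + 1))) iotaOrdEpsTau :=
  iotaLex_boundedBy iotaOrdEps_boundedBy iotaTau_boundedBy_omega0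

/-- (strat)/(drop) currency for the stratifier, strict form: `ι₀` drops iff `(ν ; ε)` drops, or ties while `τ` drops. [OURS] -/
theorem iotaOrdEpsTau_lt_iff (R : Type) [CommRing R] (g : R) (R' : Type) [CommRing R'] (g' : R') :
    iotaOrdEpsTau R g < iotaOrdEpsTau R' g' ↔
      iotaOrdEps R g < iotaOrdEps R' g' ∨ (iotaOrdEps R g = iotaOrdEps R' g' ∧ iotaTau R g < iotaTau R' g') :=
  iotaLex_lt_iff iotaTau_boundedBy_omega0 R g R' g'

/-- The stratifier is stationary iff `(ν ; ε)` and `τ` are. [OURS] -/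
theorem iotaOrdEpsTau_eq_iff (R : Type) [CommRing R] (g : R) (R' : Type) [CommRing R'] (g' : R') :
    iotaOrdEpsTau R g = iotaOrdEpsTau R' g' ↔ iotaOrdEps R g = iotaOrdEps R' g' ∧ iotaTau R g = iotaTau R' g' :=
  iotaLex_eq_iff iotaTau_boundedBy_omega0 R g R' g'

/-- Weak form. [OURS] -/
theorem iotaOrdEpsTau_le_iff (R : Type) [CommRing R] (g : R) (R' : Type) [CommRing R'] (g' : R') :
    iotaOrdEpsTau R g ≤ iotaOrdEpsTau R' g' ↔
      iotaOrdEps R g < iotaOrdEps R' g' ∨ (iotaOrdEps R g = iotaOrdEps R' g' ∧ iotaTau R g ≤ iotaTau R' g') :=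
  iotaLex_le_iff iotaTau_boundedBy_omega0 R g R' g'

/-- Unfolding of the invariant. [OURS] -/
theorem iotaFlatT_apply (R : Type) [CommRing R] (g : R) :
    iotaFlatT R g = (Ordinal.omega0 + 1) * Ordinal.omega0 * iotaOrdEpsTau R g + iotaCylinder iotaOrdEpsTau iotaSigma R g := rfl

/-- `ι₃ᵗ < ((ω+1)·ω) · (ω·(ω·(ω+1)))` (bound for further nestings / well-foundedness bookkeeping). [OURS] -/
theorem iotaFlatT_boundedBy :
    IotaBoundedBy ((Ordinal.omega0 + 1) * Ordinal.omega0 * (Ordinal.omega0 * (Ordinal.omega0 * (Ordinal.omega0 + 1))))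
      iotaFlatT :=
  iotaLex_boundedBy iotaOrdEpsTau_boundedBy (ContactCylinder.iotaCylinder_boundedBy _ _ iotaSigma_boundedBy)

/-- (strat)/(drop) currency for `ι₃ᵗ`: it drops iff the stratifier drops, or the stratifier ties and the generically-read `σ`
drops. [OURS] -/
theorem iotaFlatT_lt_iff (R : Type) [CommRing R] (g : R) (R' : Type) [CommRing R'] (g' : R') :
    iotaFlatT R g < iotaFlatT R' g' ↔
      iotaOrdEpsTau R g < iotaOrdEpsTau R' g' ∨
        (iotaOrdEpsTau R g = iotaOrdEpsTau R' g' ∧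
          iotaCylinder iotaOrdEpsTau iotaSigma R g < iotaCylinder iotaOrdEpsTau iotaSigma R' g') :=
  iotaLex_lt_iff (ContactCylinder.iotaCylinder_boundedBy _ _ iotaSigma_boundedBy) R g R' g'

/-- The invariant is stationary iff the stratifier and the generically-read `σ` are. [OURS] -/
theorem iotaFlatT_eq_iff (R : Type) [CommRing R] (g : R) (R' : Type) [CommRing R'] (g' : R') :
    iotaFlatT R g = iotaFlatT R' g' ↔
      iotaOrdEpsTau R g = iotaOrdEpsTau R' g' ∧
        iotaCylinder iotaOrdEpsTau iotaSigma R g = iotaCylinder iotaOrdEpsTau iotaSigma R' g' :=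
  iotaLex_eq_iff (ContactCylinder.iotaCylinder_boundedBy _ _ iotaSigma_boundedBy) R g R' g'

/-! ## §3 (c6τ) and (c12aτ): transport along ring isomorphisms and units -/

section Transport

variable {R T : Type} [CommRing R] [CommRing T]

/-- A tie generization is transported along a ring isomorphism (`R_𝔭 ≃ T_{e 𝔭}`, res-type-092's `locRingEquiv`). [OURS] -/
theorem isTieGenerization_of_ringEquiv (e : R ≃+* T) (f : R) (h : IsTieGenerization R f) : IsTieGenerization T (e f) := by
  obtain ⟨𝔭, h𝔭⟩ := h
  haveI : (𝔭.asIdeal.map (e : R →+* T)).IsPrime := Ideal.map_isPrime_of_equiv e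
  refine ⟨⟨𝔭.asIdeal.map (e : R →+* T), inferInstance⟩, ?_⟩
  have key := isTiePosition_of_ringEquiv (locRingEquiv e 𝔭.asIdeal (𝔭.asIdeal.map (e : R →+* T)) rfl) _ h𝔭
  rwa [locRingEquiv_apply] at key

/-- **(c6τ)** for the predicate: `IsTieGenerization T (e f) ↔ IsTieGenerization R f`. [OURS] -/
theorem isTieGenerization_ringEquiv_iff (e : R ≃+* T) (f : R) : IsTieGenerization T (e f) ↔ IsTieGenerization R f := by
  refine ⟨fun h => ?_, isTieGenerization_of_ringEquiv e f⟩
  have := isTieGenerization_of_ringEquiv e.symm (e f) h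
  rwa [e.symm_apply_apply] at this

/-- **(c12aτ)** for the predicate: multiplying by a unit does not change tie generizations. [OURS] -/
theorem isTieGenerization_unit_mul_iff {v : R} (hv : IsUnit v) (f : R) :
    IsTieGenerization R (v * f) ↔ IsTieGenerization R f := by
  unfold IsTieGenerization
  refine exists_congr fun 𝔭 => ?_
  rw [map_mul]
  exact isTiePosition_unit_mul_iff (hv.map _) _

end Transport

/-- **(c6) for `τ`.** [OURS] -/
theorem iotaTau_isoInvariant : IotaIsoInvariant iotaTau := by
  intro R T _ _ e g
  unfold iotaTau
  rw [show IsTieGenerization T (e g) ↔ IsTieGenerization R g from isTieGenerization_ringEquiv_iff e g]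

/-- **(c12a) for `τ`.** [OURS] -/
theorem iotaTau_unitInvariant : IotaUnitInvariant iotaTau := by
  intro R _ v g hv
  unfold iotaTau
  rw [show IsTieGenerization R (v * g) ↔ IsTieGenerization R g from isTieGenerization_unit_mul_iff hv g]

/-- (c6) for the stratifier `ι₀`. [OURS] -/
theorem iotaOrdEpsTau_isoInvariant : IotaIsoInvariant iotaOrdEpsTau :=
  iotaLex_isoInvariant iotaOrdEps_isoInvariant iotaTau_isoInvariant

/-- (c12a) for the stratifier `ι₀`. [OURS] -/
theorem iotaOrdEpsTau_unitInvariant : IotaUnitInvariant iotaOrdEpsTau :=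
  iotaLex_unitInvariant iotaOrdEps_unitInvariant iotaTau_unitInvariant

/-- (c6) for `ι₃ᵗ` (transfer kit + res-type-061's `iotaCylinder_isoInvariant` + res-type-073's `iotaSigma_isoInvariant`). [OURS] -/
theorem iotaFlatT_isoInvariant : IotaIsoInvariant iotaFlatT :=
  iotaLex_isoInvariant iotaOrdEpsTau_isoInvariant
    (ContactCylinder.iotaCylinder_isoInvariant _ _ iotaOrdEpsTau_isoInvariant iotaSigma_isoInvariant)

/-- (c12a) for `ι₃ᵗ`. [OURS] -/
theorem iotaFlatT_unitInvariant : IotaUnitInvariant iotaFlatT :=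
  iotaLex_unitInvariant iotaOrdEpsTau_unitInvariant
    (ContactCylinder.iotaCylinder_unitInvariant _ _ iotaOrdEpsTau_unitInvariant iotaSigma_unitInvariant)

/-! ## §4 (c7τ) UNRESTRICTED: `τ` does not increase under generization -/

section Generization

variable {R : Type} [CommRing R]

/-- A tie generization of a localisation `R_𝔭` is a tie generization of `R` (`(R_𝔭)_{𝔮'} ≅ R_{𝔮' ∩ R}` over `R`). [OURS] -/
theorem isTieGenerization_of_localization (𝔭 : Ideal R) [𝔭.IsPrime] (f : R)
    (h : IsTieGenerization (Localization.AtPrime 𝔭) (algebraMap R (Localization.AtPrime 𝔭) f)) :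
    IsTieGenerization R f := by
  obtain ⟨𝔮', h𝔮'⟩ := h
  let 𝔮 := 𝔮'.asIdeal.comap (algebraMap R (Localization.AtPrime 𝔭))
  let e : Localization.AtPrime 𝔮 ≃ₐ[R] Localization.AtPrime 𝔮'.asIdeal :=
    IsLocalization.localizationLocalizationAtPrimeIsoLocalization 𝔭.primeCompl 𝔮'.asIdeal
  have h1 : algebraMap (Localization.AtPrime 𝔭) (Localization.AtPrime 𝔮'.asIdeal)
      (algebraMap R (Localization.AtPrime 𝔭) f) = algebraMap R (Localization.AtPrime 𝔮'.asIdeal) f :=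
    (IsScalarTower.algebraMap_apply R _ _ f).symm
  have h2 : e (algebraMap R (Localization.AtPrime 𝔮) f) = algebraMap R (Localization.AtPrime 𝔮'.asIdeal) f := e.commutes f
  rw [h1, ← h2] at h𝔮'
  exact ⟨⟨𝔮, Ideal.IsPrime.comap _⟩, (isTiePosition_ringEquiv_iff e.toRingEquiv _).mp h𝔮'⟩

/-- **(c7τ)**, pointwise: `τ(R_𝔭, f) ≤ τ(R, f)` for every prime `𝔭` of every ring. [OURS] -/
theorem iotaTau_localization_le (𝔭 : Ideal R) [𝔭.IsPrime] (f : R) :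
    iotaTau (Localization.AtPrime 𝔭) (algebraMap R (Localization.AtPrime 𝔭) f) ≤ iotaTau R f := by
  rcases iotaTau_eq_zero_or_eq_one (Localization.AtPrime 𝔭) (algebraMap R (Localization.AtPrime 𝔭) f) with h | h
  · rw [h]; exact zero_le
  · rw [h, (iotaTau_eq_one_iff R f).mpr
      (isTieGenerization_of_localization 𝔭 f ((iotaTau_eq_one_iff _ _).mp h))]

end Generization

/-- **(c7) for `τ`, UNRESTRICTED** (every regular local ring, every prime). [OURS] -/
theorem iotaTau_generizationMonotone : IotaGenerizationMonotone iotaTau :=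
  fun _ _ _ 𝔭 _ f => iotaTau_localization_le 𝔭 f

/-- **(c7) for the stratifier `ι₀ = (ν ; ε ; τ)`** (transfer kit + res-type-078's `iotaOrdEps_generizationMonotone`, p528033). [OURS] -/
theorem iotaOrdEpsTau_generizationMonotone : IotaGenerizationMonotone iotaOrdEpsTau :=
  iotaLex_generizationMonotone_of iotaTau_boundedBy_omega0 iotaOrdEps_generizationMonotone iotaTau_generizationMonotone

end Iota3

end Summit.ResolutionOfSingularities.ResolutionOfSingularities.Cruxes.HypersurfaceCentreConstruction.LocalEngine

end
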